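import Mathlib
import HarnessLib
import Summits.ResolutionOfSingularities.ResolutionOfSingularities.Theorems.WildQuotientsWildQuotientResolutionS1aCuspFLocus

/-!
# S1a — R4c cusp COVER brick at `O`: in the FREE MODEL of the producer charts `[N(x₁)]`, `[N(x₂)]` over `W_O`, a RESIDUAL prime
# (`X₀′, φ′ ∈ Q`) misses the member-defining norms `N(x₂′)·N(h_O)` (chart `[N(x₁)]`) and the transition norm `N(x₁′)` (chart `[N(x₂)]`)

[OURS · L1 W4.5c · leafhand-res-wildquotients-7 g0] — NOT statements of the manuscript; counted 0; AI-level work, weaker than expert review. Crux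
stmt-ResolutionOfSingularities-17941 `CyclicQuotientFourfolds`, line `s1a-logminvertex` v13 (`stub_reachLowerInFX`), R4c `cusp_killsIn_two` (crux-dir skeleton v2,
`Lines/s1a_logminvertex-R4c-PROGRESS-v2.md`, COVER obligation 1: "residual points `R₀₁ ⊆ U_O`, `R₀₂ ⊆ O′₀₁`").

The ring certificates ✓`Cusp.cuspO_X₂_not_mem`, ✓`cuspO_normX₁_not_mem`, ✓`cuspO_hunit_not_mem`, ✓`cuspO_norms_not_mem` (`…S1aCuspFLocus`) are abstract
(any ring, any shift coefficients). This file ASSEMBLES them in the exact polynomial free model `k[s, x₀′, x₁′, x₂′, x₃]` =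
`MvPolynomial (Option (Fin 4)) k` (`s = X none`, `xᵢ′ = X (some i)`) of the member file ✓`exists_cuspO_memberChart_rel_xi` (weights `(9,2,3)`, shift `sh = 6`,
norms in the syntactic shape of ✓`KillCert.QhSym.qsc_normX1_fixed` / `qsc_normX2_fixed` / `qsc_normH_fixed` with `w 0 − (w 1 + sh) = 1`, localised root
`hh_O ↦ ∏ₗ (s²x₁′ − a + l·s⁹x₀′)`), so that the COVER step only has to transport primes of the chart ring through the free-model isomorphism `Φ`:

* ★ `cuspO_residual_not_mem_normX₁Chart` — on `[N(x₁)]` (`N(x₁′) ∉ Q`, `hh_O ∉ Q`): a prime `Q ∋ x₀′, x₂′² − x₁′³` contains none of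
  `x₂′, x₁′, h_O = 2x₂′ − 3s·x₁′², N(x₂′), N(h_O)` — so the residual points of `O′₀₁` lie in the member open `U_O = D(b_O)`,
  `E b_O = (N_R(u₂′)·N_R(ĥ))^{dbar}/c^{6p}`;
* ★ `cuspO_residual_not_mem_normX₂Chart` — on `[N(x₂)]` (`N(x₂′) ∉ Q`): a prime `Q ∋ x₀′, x₂′² − x₁′³` does not contain `x₁′` nor `N(x₁′)` — so the
  residual points of `O′₀₂` lie in `D(transition section) = O′₀₂ ∩ O′₀₁` (✓`mem_blowupChart_of_mem_basicOpen_of_mul_appLE_eq`).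
-/

set_option linter.dupNamespace false

noncomputable section

open MvPolynomial

namespace Summit.ResolutionOfSingularities.ResolutionOfSingularities.Theorems.WildQuotientResolution.S1.Cusp

variable {k : Type} [Field k] {p : ℕ} [NeZero p]

/-- ★ **Residual primes of the chart `[N(x₁)]` at `O` miss the member norms.** In `k[s, x₀′, x₁′, x₂′, x₃]`, let `Q` be a prime with `x₀′ ∈ Q`,
`x₂′² − x₁′³ ∈ Q` (a RESIDUAL prime: both residual sections vanish), not containing the chart norm `N(x₁′) = ∏ₗ (x₁′ + l·s⁶(x₀′s))` nor the
localised root `∏ₗ (s²x₁′ − a + l·s⁹x₀′)` (`9a = 4`, `3 ∈ kˣ`). Then `x₂′, x₁′, h_O = 2x₂′ − 3s x₁′², N(x₂′) = ∏ₗ (x₂′ + l·s⁶x₀′)` and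
`N(h_O) = ∏ₗ (2(x₂′ + l·s⁶x₀′) − 3s(x₁′ + l·s⁶(x₀′s))²)` are all `∉ Q`. [OURS · L1 W4.5c · R4c] -/
theorem cuspO_residual_not_mem_normX₁Chart (hk3 : (3 : k) ≠ 0) (a : k) (ha9 : a * 9 = 4)
    (Q : Ideal (MvPolynomial (Option (Fin 4)) k)) [hQ : Q.IsPrime]
    (hX₀ : (X (some 0) : MvPolynomial (Option (Fin 4)) k) ∈ Q)
    (hφ : (X (some 2) ^ 2 - X (some 1) ^ 3 : MvPolynomial (Option (Fin 4)) k) ∈ Q)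
    (hN₁ : (∏ l : ZMod p, (X (some 1) + (l.val : MvPolynomial (Option (Fin 4)) k) * (X none ^ 6 * (X (some 0) * X none ^ 1)))) ∉ Q)
    (hhh : (∏ l : ZMod p, (X none ^ 2 * X (some 1) + C (-a) + (l.val : MvPolynomial (Option (Fin 4)) k) * (X none ^ 9 * X (some 0)))) ∉ Q) :
    (X (some 2) : MvPolynomial (Option (Fin 4)) k) ∉ Q ∧ (X (some 1) : MvPolynomial (Option (Fin 4)) k) ∉ Q ∧
      (2 * X (some 2) - 3 * X none * X (some 1) ^ 2 : MvPolynomial (Option (Fin 4)) k) ∉ Q ∧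
      (∏ l : ZMod p, (X (some 2) + (l.val : MvPolynomial (Option (Fin 4)) k) * (X none ^ 6 * X (some 0)))) ∉ Q ∧
      (∏ l : ZMod p, (2 * (X (some 2) + (l.val : MvPolynomial (Option (Fin 4)) k) * (X none ^ 6 * X (some 0))) -
        3 * X none * (X (some 1) + (l.val : MvPolynomial (Option (Fin 4)) k) * (X none ^ 6 * (X (some 0) * X none ^ 1))) ^ 2)) ∉ Q := by
  -- shift coefficients
  set c₁ : ZMod p → MvPolynomial (Option (Fin 4)) k := fun l => (l.val : MvPolynomial (Option (Fin 4)) k) * X none ^ 7 with hc₁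
  set c₂ : ZMod p → MvPolynomial (Option (Fin 4)) k := fun l => (l.val : MvPolynomial (Option (Fin 4)) k) * X none ^ 6 with hc₂
  set c₃ : ZMod p → MvPolynomial (Option (Fin 4)) k := fun l => (l.val : MvPolynomial (Option (Fin 4)) k) * X none ^ 9 with hc₃
  have eN₁ : (∏ l : ZMod p, (X (some 1) + (l.val : MvPolynomial (Option (Fin 4)) k) * (X none ^ 6 * (X (some 0) * X none ^ 1)))) =
      ∏ l : ZMod p, (X (some 1) + c₁ l * X (some 0)) := Finset.prod_congr rfl fun l _ => by rw [hc₁]; ring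
  have eN₂ : (∏ l : ZMod p, (X (some 2) + (l.val : MvPolynomial (Option (Fin 4)) k) * (X none ^ 6 * X (some 0)))) =
      ∏ l : ZMod p, (X (some 2) + c₂ l * X (some 0)) := Finset.prod_congr rfl fun l _ => by rw [hc₂]; ring
  have eH : (∏ l : ZMod p, (X none ^ 2 * X (some 1) + C (-a) + (l.val : MvPolynomial (Option (Fin 4)) k) * (X none ^ 9 * X (some 0)))) =
      ∏ l : ZMod p, (X none ^ 2 * X (some 1) - C a + c₃ l * X (some 0)) := Finset.prod_congr rfl fun l _ => by rw [hc₃, map_neg]; ring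
  have eNH : (∏ l : ZMod p, (2 * (X (some 2) + (l.val : MvPolynomial (Option (Fin 4)) k) * (X none ^ 6 * X (some 0))) -
        3 * X none * (X (some 1) + (l.val : MvPolynomial (Option (Fin 4)) k) * (X none ^ 6 * (X (some 0) * X none ^ 1))) ^ 2)) =
      ∏ l : ZMod p, (2 * (X (some 2) + c₂ l * X (some 0)) - 3 * X none * (X (some 1) + c₁ l * X (some 0)) ^ 2) :=
    Finset.prod_congr rfl fun l _ => by rw [hc₁, hc₂]; ring
  rw [eN₁] at hN₁
  rw [eH] at hhh
  have hX₂ : (X (some 2) : MvPolynomial (Option (Fin 4)) k) ∉ Q := cuspO_X₂_not_mem Q (X (some 0)) (X (some 1)) (X (some 2)) c₁ hX₀ hφ hN₁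
  have hX₁ := (cuspO_normX₁_not_mem Q (X (some 0)) (X (some 1)) (X (some 2)) c₁ hX₀ hφ hX₂).1
  have h9k : (9 : k) ≠ 0 := by rw [show (9 : k) = 3 ^ 2 by norm_num]; exact pow_ne_zero 2 hk3
  have h9 : IsUnit (9 : MvPolynomial (Option (Fin 4)) k) := by
    rw [← map_ofNat (C : k →+* MvPolynomial (Option (Fin 4)) k) 9]
    exact (IsUnit.mk0 _ h9k).map C
  have h9a : (9 : MvPolynomial (Option (Fin 4)) k) * C a = 4 := by
    rw [← map_ofNat (C : k →+* MvPolynomial (Option (Fin 4)) k) 9, ← map_mul, mul_comm, ha9, map_ofNat]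
  have hO : (2 * X (some 2) - 3 * X none * X (some 1) ^ 2 : MvPolynomial (Option (Fin 4)) k) ∉ Q :=
    cuspO_hunit_not_mem Q (X none) (X (some 0)) (X (some 1)) (X (some 2)) (C a) c₁ c₃ h9 h9a hX₀ hφ hN₁ hhh
  have hnorms := cuspO_norms_not_mem Q (X none) (X (some 0)) (X (some 1)) (X (some 2)) c₂ c₁ hX₀
  refine ⟨hX₂, hX₁, hO, ?_, ?_⟩
  · rw [eN₂]; exact hnorms.1 hX₂
  · rw [eNH]; exact hnorms.2 hO

/-- ★ **Residual primes of the chart `[N(x₂)]` at `O` miss the transition norm `N(x₁′)`.** In `k[s, x₀′, x₁′, x₂′, x₃]`, a prime `Q` with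
`x₀′ ∈ Q`, `x₂′² − x₁′³ ∈ Q`, not containing the chart norm `N(x₂′) = ∏ₗ (x₂′ + l·s⁶x₀′)`, contains neither `x₂′`, nor `x₁′`, nor
`N(x₁′) = ∏ₗ (x₁′ + l·s⁶(x₀′s))`: the residual points of `O′₀₂` lie in `O′₀₂ ∩ O′₀₁`. [OURS · L1 W4.5c · R4c] -/
theorem cuspO_residual_not_mem_normX₂Chart
    (Q : Ideal (MvPolynomial (Option (Fin 4)) k)) [hQ : Q.IsPrime]
    (hX₀ : (X (some 0) : MvPolynomial (Option (Fin 4)) k) ∈ Q)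
    (hφ : (X (some 2) ^ 2 - X (some 1) ^ 3 : MvPolynomial (Option (Fin 4)) k) ∈ Q)
    (hN₂ : (∏ l : ZMod p, (X (some 2) + (l.val : MvPolynomial (Option (Fin 4)) k) * (X none ^ 6 * X (some 0)))) ∉ Q) :
    (X (some 2) : MvPolynomial (Option (Fin 4)) k) ∉ Q ∧ (X (some 1) : MvPolynomial (Option (Fin 4)) k) ∉ Q ∧
      (∏ l : ZMod p, (X (some 1) + (l.val : MvPolynomial (Option (Fin 4)) k) * (X none ^ 6 * (X (some 0) * X none ^ 1)))) ∉ Q := by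
  set c₁ : ZMod p → MvPolynomial (Option (Fin 4)) k := fun l => (l.val : MvPolynomial (Option (Fin 4)) k) * X none ^ 7 with hc₁
  set c₂ : ZMod p → MvPolynomial (Option (Fin 4)) k := fun l => (l.val : MvPolynomial (Option (Fin 4)) k) * X none ^ 6 with hc₂
  have eN₁ : (∏ l : ZMod p, (X (some 1) + (l.val : MvPolynomial (Option (Fin 4)) k) * (X none ^ 6 * (X (some 0) * X none ^ 1)))) =
      ∏ l : ZMod p, (X (some 1) + c₁ l * X (some 0)) := Finset.prod_congr rfl fun l _ => by rw [hc₁]; ring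
  have eN₂ : (∏ l : ZMod p, (X (some 2) + (l.val : MvPolynomial (Option (Fin 4)) k) * (X none ^ 6 * X (some 0)))) =
      ∏ l : ZMod p, (X (some 2) + c₂ l * X (some 0)) := Finset.prod_congr rfl fun l _ => by rw [hc₂]; ring
  rw [eN₂] at hN₂
  have hX₂ : (X (some 2) : MvPolynomial (Option (Fin 4)) k) ∉ Q := fun h => hN₂ ((prod_add_mul_mem_iff Q (X (some 2)) (X (some 0)) c₂ hX₀).mpr h)
  have h := cuspO_normX₁_not_mem Q (X (some 0)) (X (some 1)) (X (some 2)) c₁ hX₀ hφ hX₂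
  exact ⟨hX₂, h.1, by rw [eN₁]; exact h.2⟩

end Summit.ResolutionOfSingularities.ResolutionOfSingularities.Theorems.WildQuotientResolution.S1.Cusp

end
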